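import Literature.NumberTheory.Automorphic.Zelevinsky1980.JacquetOfInducedMaximalParabolic
import Literature.NumberTheory.Automorphic.Zelevinsky1980.MaximalParabolicOrbitFiltration
import Literature.NumberTheory.Automorphic.Zelevinsky1980.MaximalParabolicModulus
import Literature.NumberTheory.Automorphic.Zelevinsky1980.RankTwoUnitShell
import Literature.NumberTheory.Automorphic.SmoothIndOpenCellHaarFunctional
import Literature.NumberTheory.Automorphic.UniformizerSeparatesCharacters
import Literature.NumberTheory.Automorphic.InducedWhittakerVanishing
import Mathlib.RepresentationTheory.Coinvariants
import HarnessLib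

/-!
# The Jacquet module of `Ind_{Q_{1,1}}^{GL₂} σ'`: the open-cell part and the action of the Borel subgroup on it

Topic `NumberTheory/Automorphic` (namespace `Literature.NumberTheory.Automorphic.Zelevinsky1980`); THEOREMS ONLY (no
definition, no named fact, no `sorry`, no instance, no notation).  `F` is a non-archimedean local field with `q_F = #𝓀_F`,
`P = Q_{1,1} = standardParabolicGL F (lastBlockLabel 2)` the upper Borel subgroup of `GL₂(F)`, `U` its unipotent radical
(★ `unipotentRadicalP`), `N'` the opposite-cell radical (★ `oppositeCellRadical`; for `GL₂` both are the upper unitriangular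
matrices), `z(t) = diag(t, t)`, `d(x) = diag(1, x)`, `d₀(x) = diag(x, 1)`, `σ'` a representation of `P` on `W`
(a character when `W = ℂ`), `I = Ind_P^{GL₂} σ'` (★ `Representation.smoothIndRep`), `I_open ≤ I` the functions vanishing on the
closed cell `P` (★ `vanishingOn … (cellLT … w₀)`), `J = I_U` the `U`-coinvariants (★ `Representation.restrictUnipotentGL`) with the
`P`-action ★ `Representation.toCoinvariants`, and `K₀ = [I_open] ≤ J` the OPEN-CELL PART.  This file supplies the bookkeeping of
[BernsteinZelevinsky1977, Geometrical Lemma 2.12 ∕ Thm. 5.2 and §7.1] for the pair `(Q_{1,1}, Q_{1,1})` that the Weyl symmetry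
`i(ν ⊠ χ′) ≅ i(χ′ ⊠ ν)` (file `PrincipalSeriesGL2WeylSymmetry`) consumes:

* §1 the Borel subgroup: `p = z(t) · d(x) · u` (`exists_scalar_mul_diag_mul_unipotent`), `U ≤ N'`, `f(1) = 0 ⇒ f ∈ I_open`,
  `I_open` is `P`-stable, scalar matrices are central, `x ↦ d(x)` is multiplicative, and **a subset of `Fˣ` closed under products
  and inverses containing every uniformizer is everything** (`units_mem_of_forall_isUniformizingElement_mem`, from ★
  `monoidHom_ext_of_isUniformizingElement`);
* §2 the Jacquet module: `K₀ ≠ 0` — the standard section `Φ_{K'}` has non-zero class (`exists_mem_vanishingOn_mk_ne_zero`, by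
  the open-cell Haar functional ★ `SmoothInd.mk_coinvariants_ne_zero_of_cellFun_eq_indicator`); `U` acts trivially on `J`;
  `z(t)` acts by `σ'(z(t))`; the CLOSED-CELL exponent `[p · f] − σ'(p)[f] ∈ K₀`; the OPEN-CELL exponent `d(ϖ)` acts on `K₀` by
  `q_F σ'(d₀(ϖ))` (★ `mk_smoothIndRep_diag_eq_smul_of_mem_vanishingOn`); `K₀` is `P`-stable.

## References
* [BernsteinZelevinsky1977] I. N. Bernstein, A. V. Zelevinsky, *Induced representations of reductive `p`-adic groups. I*,
  Ann. Sci. ÉNS 10 (1977): §1.8–1.9, §2.1, Geometrical Lemma 2.12, Thm. 5.2, §7.1.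
* [Zelevinsky1980] A. V. Zelevinsky, *Induced representations of reductive `p`-adic groups. II*, Ann. Sci. ÉNS 13 (1980), §1.1, §3.2.
* [Casselman1995] W. Casselman, *Introduction to the theory of admissible representations of `p`-adic reductive groups* (draft
  1995), §6.3, Lemma 7.1.1.
* [Serre1979] J.-P. Serre, *Local Fields*, GTM 67 (1979), Chap. I §1.
-/

set_option autoImplicit false

noncomputable section

open Matrix Literature.LinearAlgebra.Matrix.DiagonalTorus
open scoped NNReal

namespace Literature.NumberTheory.Automorphic.Zelevinsky1980

open Literature.NumberTheory.Automorphic ValuativeRel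

universe u

variable {F : Type u} [Field F] [ValuativeRel F] [TopologicalSpace F] [IsNonarchimedeanLocalField F]

/-! ## §1 The Borel subgroup `Q_{1,1}` of `GL₂`: generators, its unipotent radical, the closed cell -/

section Borel

omit [ValuativeRel F] [TopologicalSpace F] [IsNonarchimedeanLocalField F] in
/-- `lastBlockLabel 2` is `(false, true)`. [cite: Zelevinsky1980, §1.1] -/
theorem lastBlockLabel_two_apply (i : Fin 2) : lastBlockLabel 2 i = decide (i = 1) := by
  fin_cases i <;> rfl

omit [ValuativeRel F] [TopologicalSpace F] [IsNonarchimedeanLocalField F] in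
/-- **Levi decomposition of `Q_{1,1}` in coordinates**: every `p ∈ Q_{1,1}` is `z(t) · d(x) · u` with `z(t) = diag(t, t)`
scalar, `d(x) = diag(1, x)` and `u ∈ U`. [cite: BernsteinZelevinsky1977, §2.1] -/
theorem exists_scalar_mul_diag_mul_unipotent (p : ↥(standardParabolicGL F (lastBlockLabel 2))) :
    ∃ (t x : Fˣ) (u : ↥(standardParabolicGL F (lastBlockLabel 2))), u ∈ unipotentRadicalP F (lastBlockLabel 2) ∧
      (p : GL (Fin 2) F) = diagGL (Fin 2) (fun _ => t) * diagGL (Fin 2) (Function.update 1 (Fin.last 1) x) *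
        (u : GL (Fin 2) F) := by
  classical
  set M : Matrix (Fin 2) (Fin 2) F := ((p : GL (Fin 2) F) : Matrix (Fin 2) (Fin 2) F) with hM
  have h10 : M 1 0 = 0 :=
    (mem_standardParabolicGL_lastBlockLabel_iff (n := 0) (p : GL (Fin 2) F)).1 p.2 0 (by decide)
  have hdet : M.det ≠ 0 := by
    rw [hM, ← Matrix.GeneralLinearGroup.val_det_apply]
    exact (Matrix.GeneralLinearGroup.det (p : GL (Fin 2) F)).ne_zero
  rw [Matrix.det_fin_two, h10, mul_zero, sub_zero] at hdet
  have ha : M 0 0 ≠ 0 := left_ne_zero_of_mul hdet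
  have hd : M 1 1 ≠ 0 := right_ne_zero_of_mul hdet
  set t : Fˣ := Units.mk0 (M 0 0) ha with ht
  set x : Fˣ := Units.mk0 (M 1 1) hd * t⁻¹ with hx
  set g : GL (Fin 2) F := diagGL (Fin 2) (fun _ => t) * diagGL (Fin 2) (Function.update 1 (Fin.last 1) x) with hg
  have hgP : g ∈ standardParabolicGL F (lastBlockLabel 2) :=
    Subgroup.mul_mem _ (diagGL_mem_standardParabolicGL _ _) (diagGL_mem_standardParabolicGL _ _)
  have hg' : g = diagGL (Fin 2) ((fun _ => t) * Function.update (1 : Fin 2 → Fˣ) (Fin.last 1) x) := by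
    rw [hg, map_mul]
  refine ⟨t, x, ⟨g⁻¹ * (p : GL (Fin 2) F), Subgroup.mul_mem _ (Subgroup.inv_mem _ hgP) p.2⟩, ?_, ?_⟩
  · -- `g⁻¹ p ∈ U`: its diagonal entries are `1`
    rw [← unipotentRadicalGL_subgroupOf, Subgroup.mem_subgroupOf, mem_unipotentRadicalGL_iff_apply]
    intro i j hij
    change (((g⁻¹ * (p : GL (Fin 2) F) : GL (Fin 2) F)) : Matrix (Fin 2) (Fin 2) F) i j = _
    rw [Units.val_mul, hg', val_inv_diagGL, Matrix.diagonal_mul, ← hM]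
    have h1 : (Fin.last 1 : Fin 2) = 1 := rfl
    have h01 : (0 : Fin 2) ≠ Fin.last 1 := by decide
    fin_cases i <;> fin_cases j
    · simp [ht, inv_mul_cancel₀ ha]
    · exact absurd hij (by decide)
    · simp [h10]
    · simp [h1, hx, ht, mul_comm, inv_mul_cancel₀ hd]
  · rw [mul_inv_cancel_left]

omit [ValuativeRel F] [TopologicalSpace F] [IsNonarchimedeanLocalField F] in
/-- For `GL₂` the unipotent radical `U` of `Q_{1,1}` is the opposite-cell radical `N'` (both are the upper
unitriangular matrices). [cite: BernsteinZelevinsky1977, §7.1] -/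
theorem coe_mem_oppositeCellRadical_of_mem_unipotentRadicalP {u : ↥(standardParabolicGL F (lastBlockLabel 2))}
    (hu : u ∈ unipotentRadicalP F (lastBlockLabel 2)) :
    (u : GL (Fin 2) F) ∈ oppositeCellRadical (K := F) (lastBlockLabel 2) := by
  rw [← unipotentRadicalGL_subgroupOf, Subgroup.mem_subgroupOf, mem_unipotentRadicalGL_iff_apply] at hu
  rw [mem_oppositeCellRadical_lastBlockLabel_iff]
  intro i j hij
  refine hu i j ?_
  fin_cases i <;> fin_cases j
  · exact le_rfl
  · exact absurd ⟨rfl, by decide⟩ hij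
  · decide
  · exact le_rfl

/-- A function of `Ind_{Q_{1,1}}^{GL₂} σ'` vanishing at `1` vanishes on the closed cell `Q_{1,1}` (i.e. lies in
`I_open`). [cite: BernsteinZelevinsky1977, §7.1] -/
theorem mem_vanishingOn_of_toFun_one_eq_zero {W : Type*} [AddCommGroup W] [Module ℂ W]
    {σ' : Representation ℂ ↥(standardParabolicGL F (lastBlockLabel 2)) W}
    (f : Representation.SmoothInd (standardParabolicGL F (lastBlockLabel 2)) σ') (hf : f.toFun 1 = 0) :
    f ∈ vanishingOn (standardParabolicGL F (lastBlockLabel 2)) σ' (cellLT (K := F) (lastBlockLabel 2) Fin.revPerm) := by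
  intro g hg
  have hgP : g ∈ standardParabolicGL F (lastBlockLabel 2) := by
    rw [mem_standardParabolicGL_lastBlockLabel_iff (n := 0)]
    intro j hj
    have hj0 : j = 0 := by
      fin_cases j
      · rfl
      · exact absurd rfl hj
    rw [hj0]
    exact (mem_cellLT_rev_iff_apply_eq_zero (n := 0) g).1 hg
  rw [show g = ((⟨g, hgP⟩ : ↥(standardParabolicGL F (lastBlockLabel 2))) : GL (Fin 2) F) * 1 from (mul_one g).symm,
    Representation.SmoothInd.toFun_subgroup_mul, hf, map_zero]

/-- `I_open` is stable under `Q_{1,1}` (right translation by `p ∈ P` preserves the closed cell `P`).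
[cite: BernsteinZelevinsky1977, §7.1] -/
theorem smoothIndRep_mem_vanishingOn {W : Type*} [AddCommGroup W] [Module ℂ W]
    {σ' : Representation ℂ ↥(standardParabolicGL F (lastBlockLabel 2)) W}
    (p : ↥(standardParabolicGL F (lastBlockLabel 2)))
    {f : Representation.SmoothInd (standardParabolicGL F (lastBlockLabel 2)) σ'}
    (hf : f ∈ vanishingOn (standardParabolicGL F (lastBlockLabel 2)) σ' (cellLT (K := F) (lastBlockLabel 2) Fin.revPerm)) :
    Representation.smoothIndRep (standardParabolicGL F (lastBlockLabel 2)) σ' (p : GL (Fin 2) F) f ∈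
      vanishingOn (standardParabolicGL F (lastBlockLabel 2)) σ' (cellLT (K := F) (lastBlockLabel 2) Fin.revPerm) := by
  intro g hg
  rw [Representation.toFun_smoothIndRep_apply]
  refine hf _ ?_
  rw [mem_cellLT_rev_iff_apply_eq_zero (n := 0)] at hg ⊢
  have hp10 := (mem_standardParabolicGL_lastBlockLabel_iff (n := 0) (p : GL (Fin 2) F)).1 p.2 0 (by decide)
  rw [Units.val_mul, Matrix.mul_apply, Fin.sum_univ_two]
  change (g : Matrix (Fin 2) (Fin 2) F) 1 0 * _ + (g : Matrix (Fin 2) (Fin 2) F) 1 1 * ((p : GL (Fin 2) F) : Matrix (Fin 2) (Fin 2) F) 1 0 = 0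
  rw [show ((g : Matrix (Fin 2) (Fin 2) F) 1 0) = 0 from hg, zero_mul, zero_add,
    show ((p : GL (Fin 2) F) : Matrix (Fin 2) (Fin 2) F) 1 0 = 0 from hp10, mul_zero]

omit [ValuativeRel F] [TopologicalSpace F] [IsNonarchimedeanLocalField F] in
/-- Scalar matrices are central in `GL₂`. [cite: BernsteinZelevinsky1977, §2.1] -/
theorem mul_diagGL_const_comm (g : GL (Fin 2) F) (t : Fˣ) :
    g * diagGL (Fin 2) (fun _ => t) = diagGL (Fin 2) (fun _ => t) * g := by
  refine Units.ext ?_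
  rw [Units.val_mul, Units.val_mul, val_diagGL]
  ext i j
  rw [Matrix.mul_diagonal, Matrix.diagonal_mul, mul_comm]

omit [ValuativeRel F] [TopologicalSpace F] [IsNonarchimedeanLocalField F] in
/-- A one-dimensional representation of `Q_{1,1}` acts by the scalars `σ'(p) 1`. [cite: Zelevinsky1980, §3.2 Example] -/
theorem apply_eq_mul_apply_one_two (σ' : Representation ℂ ↥(standardParabolicGL F (lastBlockLabel 2)) ℂ)
    (p : ↥(standardParabolicGL F (lastBlockLabel 2))) (z : ℂ) : σ' p z = σ' p 1 * z := by
  rw [mul_comm, ← smul_eq_mul, ← map_smul, smul_eq_mul, mul_one]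

end Borel

/-! ## §2 The Jacquet module of `Ind_{Q_{1,1}}^{GL₂} σ'`: the open-cell part `K₀` and the action of `Q_{1,1}` -/

section Functional

variable (σ' σ'' : Representation ℂ ↥(standardParabolicGL F (lastBlockLabel 2)) ℂ)

/-- **The `U`-coinvariants see only `U ≤ N'`**: a vector of `Ind_{Q_{1,1}}^{GL₂} σ'` whose class in the `U`-coinvariants
(`U` the unipotent radical of `Q_{1,1}`) vanishes has vanishing class in the `N'`-coinvariants (`N'` the opposite-cell
radical; for `GL₂` both are the upper unitriangular group). [cite: BernsteinZelevinsky1977, §1.8 and §7.1] -/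
theorem mk_comp_oppositeCellRadical_eq_zero
    (f : Representation.SmoothInd (standardParabolicGL F (lastBlockLabel 2)) σ')
    (hf : Representation.Coinvariants.mk (Representation.restrictUnipotentGL F (lastBlockLabel 2)
      (Representation.smoothIndRep (standardParabolicGL F (lastBlockLabel 2)) σ')) f = 0) :
    Representation.Coinvariants.mk ((Representation.smoothIndRep (standardParabolicGL F (lastBlockLabel 2)) σ').comp
      (oppositeCellRadical (K := F) (lastBlockLabel 2)).subtype) f = 0 := by
  rw [Representation.Coinvariants.mk_eq_zero] at hf ⊢
  refine (Submodule.span_le.2 ?_) hf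
  rintro _ ⟨⟨u, v⟩, rfl⟩
  exact Representation.Coinvariants.sub_mem_ker
    (ρ := (Representation.smoothIndRep (standardParabolicGL F (lastBlockLabel 2)) σ').comp
      (oppositeCellRadical (K := F) (lastBlockLabel 2)).subtype)
    ⟨((u : ↥(standardParabolicGL F (lastBlockLabel 2))) : GL (Fin 2) F),
      coe_mem_oppositeCellRadical_of_mem_unipotentRadicalP u.2⟩ v

/-- **The open cell survives in the Jacquet module of `Ind_{Q_{1,1}}^{GL₂} σ'`**: for `σ'` smooth there is a function
`f₀ ∈ I_open` (vanishing on the closed cell) whose class in the `U`-coinvariants is non-zero — the standard section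
`Φ_{K'}` of a compact open `K' ≤ N'`, detected by the open-cell Haar functional
(★ `SmoothInd.mk_coinvariants_ne_zero_of_cellFun_eq_indicator`). [cite: BernsteinZelevinsky1977, Geometrical Lemma 2.12 and §5 (5.2)]
[cite: Casselman1995, Lemma 7.1.1 (a)] -/
theorem exists_mem_vanishingOn_mk_ne_zero (hσ' : σ'.IsSmooth) :
    ∃ f₀ : Representation.SmoothInd (standardParabolicGL F (lastBlockLabel 2)) σ',
      f₀ ∈ vanishingOn (standardParabolicGL F (lastBlockLabel 2)) σ' (cellLT (K := F) (lastBlockLabel 2) Fin.revPerm) ∧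
      Representation.Coinvariants.mk (Representation.restrictUnipotentGL F (lastBlockLabel 2)
        (Representation.smoothIndRep (standardParabolicGL F (lastBlockLabel 2)) σ')) f₀ ≠ 0 := by
  classical
  have hc : Monotone (lastBlockLabel 2) := monotone_lastBlockLabel 2
  -- a compact open subgroup `K' = N' ∩ K_1` of `N'`
  set K' : Subgroup ↥(oppositeCellRadical (K := F) (lastBlockLabel 2)) :=
    (congruenceGL 2 (1 : ValueGroupWithZero F)).comap (oppositeCellRadical (K := F) (lastBlockLabel 2)).subtype
    with hK'_def
  have hK'o : IsOpen (K' : Set ↥(oppositeCellRadical (K := F) (lastBlockLabel 2))) := isOpen_comap_congruenceGL one_ne_zero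
  have hK'c : IsCompact (K' : Set ↥(oppositeCellRadical (K := F) (lastBlockLabel 2))) := isCompact_comap_congruenceGL _
  refine ⟨cellSection σ' hc hσ' K' hK'o hK'c 1, cellSection_mem_vanishingOn σ' hc hσ' K' hK'o hK'c 1, fun h0 => ?_⟩
  have hlim : IsLimitOfCompactOpen ↥(oppositeCellRadical (K := F) (lastBlockLabel 2)) :=
    isLimitOfCompactOpen_unipotentRadicalGL F (⇑OrderDual.toDual ∘ revLabel (lastBlockLabel 2))
      (monotone_toDual_revLabel (lastBlockLabel 2) hc)
  refine SmoothInd.mk_coinvariants_ne_zero_of_cellFun_eq_indicator (standardParabolicGL F (lastBlockLabel 2)) σ'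
    (oppositeCellRadical (K := F) (lastBlockLabel 2)).subtype (permGL Fin.revPerm) hlim continuous_subtype_val
    (cellSection σ' hc hσ' K' hK'o hK'c 1) hK'o hK'c ⟨1, K'.one_mem⟩ (w := (1 : ℂ)) one_ne_zero (fun γ => ?_)
    (mk_comp_oppositeCellRadical_eq_zero σ' _ h0)
  rw [toFun_cellSection, Subgroup.coe_subtype, ← one_mul (permGL Fin.revPerm : GL (Fin 2) F)]
  by_cases hγ : γ ∈ K'
  · rw [Set.indicator_of_mem hγ, cellSectionFun_eq_of_mem hc (1 : ℂ) (Subgroup.one_mem _) γ.2 (by exact hγ)]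
    change σ' 1 1 = 1
    rw [map_one σ']
    rfl
  · rw [Set.indicator_of_notMem hγ, cellSectionFun_eq_zero_of_not_mem hc (1 : ℂ) (Subgroup.one_mem _) γ.2 (by exact hγ)]

/-- **`U` acts trivially on the `U`-coinvariants** (the `P`-action ★ `Representation.toCoinvariants` on the Jacquet module
of `Ind_{Q_{1,1}}^{GL₂} σ'`). [cite: BernsteinZelevinsky1977, §1.8] -/
theorem toCoinvariants_apply_of_mem_unipotentRadicalP (u : ↥(standardParabolicGL F (lastBlockLabel 2))) (hu : u ∈ (unipotentRadicalP F (lastBlockLabel 2))) (y : (Representation.restrictUnipotentGL F (lastBlockLabel 2) (Representation.smoothIndRep (standardParabolicGL F (lastBlockLabel 2)) σ')).Coinvariants) :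
    (Representation.toCoinvariants ((Representation.smoothIndRep (standardParabolicGL F (lastBlockLabel 2)) σ').comp (standardParabolicGL F (lastBlockLabel 2)).subtype) (unipotentRadicalP F (lastBlockLabel 2))) u y = y := by
  obtain ⟨f, rfl⟩ := Representation.Coinvariants.mk_surjective (Representation.restrictUnipotentGL F (lastBlockLabel 2) (Representation.smoothIndRep (standardParabolicGL F (lastBlockLabel 2)) σ')) y
  rw [Representation.toCoinvariants_mk]
  exact Representation.Coinvariants.mk_self_apply (Representation.restrictUnipotentGL F (lastBlockLabel 2) (Representation.smoothIndRep (standardParabolicGL F (lastBlockLabel 2)) σ')) ⟨u, hu⟩ f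

/-- **Scalar matrices act on the Jacquet module by the central character** `σ'(z(t))`. [cite: BernsteinZelevinsky1977, §2.1] -/
theorem toCoinvariants_scalar_apply (t : Fˣ) (y : (Representation.restrictUnipotentGL F (lastBlockLabel 2) (Representation.smoothIndRep (standardParabolicGL F (lastBlockLabel 2)) σ')).Coinvariants) :
    (Representation.toCoinvariants ((Representation.smoothIndRep (standardParabolicGL F (lastBlockLabel 2)) σ').comp (standardParabolicGL F (lastBlockLabel 2)).subtype) (unipotentRadicalP F (lastBlockLabel 2))) (⟨diagGL (Fin 2) (fun _ => t), diagGL_mem_standardParabolicGL _ _⟩ : ↥(standardParabolicGL F (lastBlockLabel 2))) y = σ' (⟨diagGL (Fin 2) (fun _ => t), diagGL_mem_standardParabolicGL _ _⟩ : ↥(standardParabolicGL F (lastBlockLabel 2))) 1 • y := by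
  obtain ⟨f, rfl⟩ := Representation.Coinvariants.mk_surjective (Representation.restrictUnipotentGL F (lastBlockLabel 2) (Representation.smoothIndRep (standardParabolicGL F (lastBlockLabel 2)) σ')) y
  rw [Representation.toCoinvariants_mk, ← map_smul]
  congr 1
  refine Representation.SmoothInd.ext (funext fun g => ?_)
  change ((Representation.smoothIndRep (standardParabolicGL F (lastBlockLabel 2)) σ') (diagGL (Fin 2) fun _ => t) f).toFun g = _
  rw [Representation.toFun_smoothIndRep_apply, Representation.SmoothInd.toFun_smul, Pi.smul_apply, smul_eq_mul,
    mul_diagGL_const_comm,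
    show diagGL (Fin 2) (fun _ => t) * g = (((⟨diagGL (Fin 2) (fun _ => t), diagGL_mem_standardParabolicGL _ _⟩ : ↥(standardParabolicGL F (lastBlockLabel 2)))) : GL (Fin 2) F) * g from rfl,
    Representation.SmoothInd.toFun_subgroup_mul, apply_eq_mul_apply_one_two]

/-- **The closed-cell exponent**: `[p · f] − σ'(p) [f]` lies in the open-cell part `K₀ = [I_open]` of the Jacquet module
(`(p · f − σ'(p) f)(1) = 0`). [cite: BernsteinZelevinsky1977, Thm. 5.2 and §7.1] -/
theorem mk_smoothIndRep_sub_smul_mem (p : ↥(standardParabolicGL F (lastBlockLabel 2))) (f : (Representation.SmoothInd (standardParabolicGL F (lastBlockLabel 2)) σ')) :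
    (Representation.Coinvariants.mk (Representation.restrictUnipotentGL F (lastBlockLabel 2) (Representation.smoothIndRep (standardParabolicGL F (lastBlockLabel 2)) σ'))) ((Representation.smoothIndRep (standardParabolicGL F (lastBlockLabel 2)) σ') (p : GL (Fin 2) F) f) - σ' p 1 • (Representation.Coinvariants.mk (Representation.restrictUnipotentGL F (lastBlockLabel 2) (Representation.smoothIndRep (standardParabolicGL F (lastBlockLabel 2)) σ'))) f ∈ (Submodule.map (Representation.Coinvariants.mk (Representation.restrictUnipotentGL F (lastBlockLabel 2) (Representation.smoothIndRep (standardParabolicGL F (lastBlockLabel 2)) σ'))) (vanishingOn (standardParabolicGL F (lastBlockLabel 2)) σ' (cellLT (K := F) (lastBlockLabel 2) Fin.revPerm))) := by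
  refine Submodule.mem_map.2 ⟨(Representation.smoothIndRep (standardParabolicGL F (lastBlockLabel 2)) σ') (p : GL (Fin 2) F) f - σ' p 1 • f, ?_, by rw [map_sub, map_smul]⟩
  refine mem_vanishingOn_of_toFun_one_eq_zero _ ?_
  rw [← Representation.SmoothInd.toFunₗ_apply, map_sub, map_smul, Representation.SmoothInd.toFunₗ_apply,
    Representation.SmoothInd.toFunₗ_apply, Pi.sub_apply, Pi.smul_apply, smul_eq_mul,
    Representation.toFun_smoothIndRep_apply, one_mul, ← mul_one (p : GL (Fin 2) F),
    Representation.SmoothInd.toFun_subgroup_mul, apply_eq_mul_apply_one_two, sub_self]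

/-- **The open-cell exponent** (★ `mk_smoothIndRep_diag_eq_smul_of_mem_vanishingOn` for `Q_{1,1}`): on `K₀` the element
`d(ϖ) = diag(1, ϖ)` acts by `q_F · σ'(d₀(ϖ))`, `d₀(ϖ) = diag(ϖ, 1)`. [cite: BernsteinZelevinsky1977, Thm. 5.2 and §7.1] -/
theorem toCoinvariants_diag_uniformizer_apply_of_mem (hσ' : σ'.IsSmooth) {ϖ : F} (hϖ : IsUniformizingElement ϖ)
    (y : (Representation.restrictUnipotentGL F (lastBlockLabel 2) (Representation.smoothIndRep (standardParabolicGL F (lastBlockLabel 2)) σ')).Coinvariants) (hy : y ∈ (Submodule.map (Representation.Coinvariants.mk (Representation.restrictUnipotentGL F (lastBlockLabel 2) (Representation.smoothIndRep (standardParabolicGL F (lastBlockLabel 2)) σ'))) (vanishingOn (standardParabolicGL F (lastBlockLabel 2)) σ' (cellLT (K := F) (lastBlockLabel 2) Fin.revPerm)))) :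
    (Representation.toCoinvariants ((Representation.smoothIndRep (standardParabolicGL F (lastBlockLabel 2)) σ').comp (standardParabolicGL F (lastBlockLabel 2)).subtype) (unipotentRadicalP F (lastBlockLabel 2))) (⟨diagGL (Fin 2) (Function.update 1 (Fin.last 1) (Units.mk0 ϖ hϖ.ne_zero)), diagGL_mem_standardParabolicGL _ _⟩ : ↥(standardParabolicGL F (lastBlockLabel 2))) y =
      ((GaloisRepresentations.IsNonarchimedeanLocalField.residueFieldCard F : ℂ) * σ' (⟨diagGL (Fin 2) (Function.update 1 0 (Units.mk0 ϖ hϖ.ne_zero)), diagGL_mem_standardParabolicGL _ _⟩ : ↥(standardParabolicGL F (lastBlockLabel 2))) 1) • y := by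
  obtain ⟨f, hf, rfl⟩ := Submodule.mem_map.1 hy
  rw [Representation.toCoinvariants_mk]
  exact mk_smoothIndRep_diag_eq_smul_of_mem_vanishingOn σ' hσ' hϖ
    (s := σ' (⟨diagGL (Fin 2) (Function.update 1 0 (Units.mk0 ϖ hϖ.ne_zero)), diagGL_mem_standardParabolicGL _ _⟩ : ↥(standardParabolicGL F (lastBlockLabel 2))) 1)
    (fun w => by rw [smul_eq_mul]; exact apply_eq_mul_apply_one_two σ' _ w) f hf

/-- `K₀ = [I_open]` is stable under `Q_{1,1}`. [cite: BernsteinZelevinsky1977, §7.1] -/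
theorem toCoinvariants_apply_mem_of_mem (p : ↥(standardParabolicGL F (lastBlockLabel 2))) {y : (Representation.restrictUnipotentGL F (lastBlockLabel 2) (Representation.smoothIndRep (standardParabolicGL F (lastBlockLabel 2)) σ')).Coinvariants} (hy : y ∈ (Submodule.map (Representation.Coinvariants.mk (Representation.restrictUnipotentGL F (lastBlockLabel 2) (Representation.smoothIndRep (standardParabolicGL F (lastBlockLabel 2)) σ'))) (vanishingOn (standardParabolicGL F (lastBlockLabel 2)) σ' (cellLT (K := F) (lastBlockLabel 2) Fin.revPerm)))) :
    (Representation.toCoinvariants ((Representation.smoothIndRep (standardParabolicGL F (lastBlockLabel 2)) σ').comp (standardParabolicGL F (lastBlockLabel 2)).subtype) (unipotentRadicalP F (lastBlockLabel 2))) p y ∈ (Submodule.map (Representation.Coinvariants.mk (Representation.restrictUnipotentGL F (lastBlockLabel 2) (Representation.smoothIndRep (standardParabolicGL F (lastBlockLabel 2)) σ'))) (vanishingOn (standardParabolicGL F (lastBlockLabel 2)) σ' (cellLT (K := F) (lastBlockLabel 2) Fin.revPerm))) := by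
  obtain ⟨f, hf, rfl⟩ := Submodule.mem_map.1 hy
  rw [Representation.toCoinvariants_mk]
  exact Submodule.mem_map.2 ⟨_, smoothIndRep_mem_vanishingOn p hf, rfl⟩

/-- **A subset of `Fˣ` closed under products and inverses which contains every uniformizer is everything** — `Fˣ` is
generated by its uniformizers (`x = ϖ^a e` with `|e| = 1`, and `e ϖ` is again a uniformizer; ★
`monoidHom_ext_of_isUniformizingElement`). [cite: Serre1979, Chap. I §1] -/
theorem units_mem_of_forall_isUniformizingElement_mem {S : Set Fˣ} (h1 : (1 : Fˣ) ∈ S)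
    (hmul : ∀ a b : Fˣ, a ∈ S → b ∈ S → a * b ∈ S) (hinv : ∀ a : Fˣ, a ∈ S → a⁻¹ ∈ S)
    (hunif : ∀ (ϖ : F) (hϖ : IsUniformizingElement ϖ), Units.mk0 ϖ hϖ.ne_zero ∈ S) (x : Fˣ) : x ∈ S := by
  let H : Subgroup Fˣ :=
    { carrier := S
      mul_mem' := fun {a b} ha hb => hmul a b ha hb
      one_mem' := h1
      inv_mem' := fun {a} ha => hinv a ha }
  have key : QuotientGroup.mk' H = 1 :=
    monoidHom_ext_of_isUniformizingElement fun ϖ hϖ => by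
      rw [MonoidHom.one_apply, QuotientGroup.mk'_apply, QuotientGroup.eq_one_iff]
      exact hunif ϖ hϖ
  have hx : x ∈ H := by
    rw [← QuotientGroup.eq_one_iff, ← QuotientGroup.mk'_apply, key, MonoidHom.one_apply]
  exact hx

omit [ValuativeRel F] [TopologicalSpace F] [IsNonarchimedeanLocalField F] in
/-- `x ↦ d(x) = diag(1, x)` is multiplicative. [cite: BernsteinZelevinsky1977, §2.1] -/
theorem diagLast_mul (a b : Fˣ) : (⟨diagGL (Fin 2) (Function.update 1 (Fin.last 1) (a * b)), diagGL_mem_standardParabolicGL _ _⟩ : ↥(standardParabolicGL F (lastBlockLabel 2))) = (⟨diagGL (Fin 2) (Function.update 1 (Fin.last 1) a), diagGL_mem_standardParabolicGL _ _⟩ : ↥(standardParabolicGL F (lastBlockLabel 2))) * (⟨diagGL (Fin 2) (Function.update 1 (Fin.last 1) b), diagGL_mem_standardParabolicGL _ _⟩ : ↥(standardParabolicGL F (lastBlockLabel 2))) :=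
  Subtype.ext (by
    change diagGL (Fin 2) (Pi.mulSingle (Fin.last 1) (a * b)) =
      diagGL (Fin 2) (Pi.mulSingle (Fin.last 1) a) * diagGL (Fin 2) (Pi.mulSingle (Fin.last 1) b)
    rw [Pi.mulSingle_mul, map_mul])

omit [ValuativeRel F] [TopologicalSpace F] [IsNonarchimedeanLocalField F] in
/-- `d(1) = 1`. [cite: BernsteinZelevinsky1977, §2.1] -/
theorem diagLast_one : (⟨diagGL (Fin 2) (Function.update 1 (Fin.last 1) 1), diagGL_mem_standardParabolicGL _ _⟩ : ↥(standardParabolicGL F (lastBlockLabel 2))) = 1 :=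
  Subtype.ext (by
    change diagGL (Fin 2) (Pi.mulSingle (Fin.last 1) (1 : Fˣ)) = 1
    rw [Pi.mulSingle_one, map_one])

omit [ValuativeRel F] [TopologicalSpace F] [IsNonarchimedeanLocalField F] in
/-- `d(a⁻¹) = d(a)⁻¹`. [cite: BernsteinZelevinsky1977, §2.1] -/
theorem diagLast_inv (a : Fˣ) : (⟨diagGL (Fin 2) (Function.update 1 (Fin.last 1) a⁻¹), diagGL_mem_standardParabolicGL _ _⟩ : ↥(standardParabolicGL F (lastBlockLabel 2))) = (⟨diagGL (Fin 2) (Function.update 1 (Fin.last 1) a), diagGL_mem_standardParabolicGL _ _⟩ : ↥(standardParabolicGL F (lastBlockLabel 2)))⁻¹ :=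
  eq_inv_of_mul_eq_one_left (by rw [← diagLast_mul, inv_mul_cancel, diagLast_one])

end Functional

end Literature.NumberTheory.Automorphic.Zelevinsky1980

end
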